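import Summits.HubbardSuperconductivity.HubbardSuperconductivity.Theorems.KLProgrammeKLRegimeScaleZeroAbelSummation
import Summits.HubbardSuperconductivity.HubbardSuperconductivity.Theorems.KLProgrammeKLRegimeScaleZeroCovarianceOffSiteWindow
import Summits.HubbardSuperconductivity.HubbardSuperconductivity.Theorems.KLProgrammeKLRegimeScaleZeroCovarianceKernelFreqRegularity

/-!
# Route `KLProgramme`, crux K3 — engine-flow child (stmt-HubbardSuperconductivity-20437), stub (C) at `n = 0`, located brick «A-SIZES-WEIGHTED» (pen (R181)),
# brick 4b: TIME DECAY OF A MATSUBARA WINDOW SUM ON THE GRID from frequency jets, by iterated Abel summation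

Cell gate-hubbard-kl, seat p1 g21.  An entry of the scale-`0` grid covariance between grid times `τ₁ − τ₀ = (j₁ − j₀)β/4M` is
`(1/β)Σ_{n<2M} e^{iω_nΔτ} H(ω_n)` with `ω_n = ω₀ + n·2π/β`, i.e. `(1/β)e^{iω₀Δτ}Σ_{n<2M} qⁿH(ω_n)` with the grid phase ratio `q = e^{2πi(j₁−j₀)/4M}`,
`‖q − 1‖ = 2|sin(π(j₁−j₀)/4M)| ≥ v/M` (`v` = the cyclic distance of `j₁, j₀` on `ℤ/4M`).  If `‖H^{(i)}(ω)‖ ≤ A_i/max(|ω|,Λ/2)^{i+1}` (`i ≤ N′`),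
brick 4a's iterated Abel summation gives (**`norm_windowSum_le_of_jets`**)
`‖Σ_{n<2M} qⁿH(ω_n)‖ ≤ β·Σ_{i<N′} 2max(i,1)2ⁱA_i/(π v^{i+1}) + N′·A_{N′}·2π(2/Λ)^{N′}·(2π/β)^{N′−1}·(M/v)^{N′}`
(`M ≥ 2N′+1`): the edge (Gibbs) terms `O(1/v)` of the sharp window and the bulk `O((M/(βv))^{N′}) = O(d_t^{−N′})` in the grid time distance `d_t = βv/4M`.
Also: `integral_one_div_max_abs_pow_le` (`∫ max(|ω|,a)^{−p} ≤ 2π a^{1−p}`), the phase-ratio geometry (`four_mul_abs_sub_le_norm_cexp_sub_one`,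
`cyclicDist_div_le_norm_gridPhase_sub_one`), `matsubaraFreq_eq_affine`, and the no-decay window bound `sum_matsubaraIdx_one_div_max_sq_le`.

Proofs only; no definitions; nothing here asserts (C), any stub of 20437, K3 or superconductivity.  References: BGM 2006 §2.2 (2.36aa)
[cite: BenfattoGiulianiMastropietro2006]; Salmhofer 1999 §4.2.4 (4.63) [cite: Salmhofer1999].
-/

noncomputable section

namespace Summit.HubbardSuperconductivity.HubbardSuperconductivity.Theorems.KLRegimeSplit

set_option linter.dupNamespace false -- summit = problem name (single-conjunct summit), D-0017

open Finset Complex Real MeasureTheory intervalIntegral Set Literature.MathematicalPhysics.QuantumLattice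
open scoped fwdDiff

/-! ## §1 The envelope integral `∫ max(|ω|, a)^{-p} dω ≤ 2π·a^{1−p}` -/

/-- **`∫_ℝ max(|ω|,a)^{−p}dω ≤ 2π·(1/a)^{p−1}`** (`0 < a`, `p ≥ 2`; domination by `(1/a)^{p−2}·(2/a²)(1+(ω/a)²)⁻¹`). -/
theorem integral_one_div_max_abs_pow_le {a : ℝ} (ha : 0 < a) {p : ℕ} (hp : 2 ≤ p) :
    ∫ x : ℝ, 1 / max |x| a ^ p ≤ 2 * π * (1 / a) ^ (p - 1) := by
  obtain ⟨q, rfl⟩ : ∃ q, p = q + 2 := ⟨p - 2, by omega⟩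
  have hdom : Integrable (fun x : ℝ => (1 / a) ^ q * ((2 / a ^ 2) * (1 + (x / a) ^ 2)⁻¹)) :=
    ((integrable_inv_one_add_sq.comp_div ha.ne').const_mul (2 / a ^ 2)).const_mul ((1 / a) ^ q)
  have hpt : ∀ x : ℝ, 1 / max |x| a ^ (q + 2) ≤ (1 / a) ^ q * ((2 / a ^ 2) * (1 + (x / a) ^ 2)⁻¹) := by
    intro x
    have hm : 0 < max |x| a := lt_max_of_lt_right ha
    have hmax : x ^ 2 + a ^ 2 ≤ 2 * max |x| a ^ 2 := by
      have h1 : x ^ 2 ≤ max |x| a ^ 2 := by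
        rw [← sq_abs x]; exact pow_le_pow_left₀ (abs_nonneg _) (le_max_left _ _) 2
      have h2 : a ^ 2 ≤ max |x| a ^ 2 := pow_le_pow_left₀ ha.le (le_max_right _ _) 2
      linarith
    have hωa : 0 < x ^ 2 + a ^ 2 := by positivity
    calc 1 / max |x| a ^ (q + 2) = 1 / (max |x| a ^ q * max |x| a ^ 2) := by rw [pow_add]
      _ ≤ 1 / (a ^ q * ((x ^ 2 + a ^ 2) / 2)) := by
          apply one_div_le_one_div_of_le (by positivity)
          exact mul_le_mul (pow_le_pow_left₀ ha.le (le_max_right _ _) q) (by linarith) (by positivity) (by positivity)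
      _ = (1 / a) ^ q * ((2 / a ^ 2) * (1 + (x / a) ^ 2)⁻¹) := by
          rw [one_div_pow]
          field_simp
          ring
  calc ∫ x : ℝ, 1 / max |x| a ^ (q + 2) ≤ ∫ x : ℝ, (1 / a) ^ q * ((2 / a ^ 2) * (1 + (x / a) ^ 2)⁻¹) :=
        integral_mono_of_nonneg (ae_of_all _ fun x => by positivity) hdom (ae_of_all _ hpt)
    _ = (1 / a) ^ q * ((2 / a ^ 2) * (|a| * π)) := by
        rw [MeasureTheory.integral_const_mul, MeasureTheory.integral_const_mul]
        have h := Measure.integral_comp_div (fun y : ℝ => (1 + y ^ 2)⁻¹) a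
        simp only [smul_eq_mul] at h
        rw [h, integral_univ_inv_one_add_sq]
    _ = 2 * π * (1 / a) ^ (q + 2 - 1) := by
        have ha' : a ≠ 0 := ha.ne'
        rw [abs_of_pos ha, show q + 2 - 1 = q + 1 by omega, pow_succ, one_div_pow, one_div_pow]
        field_simp
        ring

/-! ## §2 The grid phase ratio: `‖e^{2πix} − 1‖ = 2|sin πx| ≥ 4·dist(x, ℤ)` -/

/-- `‖e^{i·2πx} − 1‖ ≥ 4|x − k|` for every integer `k` with `|x − k| ≤ 1/2` (Jordan's inequality). -/
theorem four_mul_abs_sub_le_norm_cexp_sub_one (x : ℝ) (k : ℤ) (hk : |x - k| ≤ 1 / 2) :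
    4 * |x - k| ≤ ‖cexp (I * ((2 * π * x : ℝ) : ℂ)) - 1‖ := by
  rw [Complex.norm_exp_I_mul_ofReal_sub_one]
  have hper : Real.sin (2 * π * x / 2) = (-1) ^ k * Real.sin (π * (x - k)) := by
    rw [show 2 * π * x / 2 = π * (x - k) + k * π by ring, Real.sin_add_int_mul_pi]
  rw [hper, Real.norm_eq_abs, abs_mul, abs_mul, abs_neg_one_zpow, one_mul, abs_two]
  -- `|sin(π y)| ≥ 2|y|` for `|y| ≤ 1/2`
  have key : ∀ y : ℝ, 0 ≤ y → y ≤ 1 / 2 → 2 * y ≤ Real.sin (π * y) := fun y hy0 hy => by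
    have h := Real.mul_le_sin (x := π * y) (by positivity) (by nlinarith [Real.pi_pos])
    calc 2 * y = 2 / π * (π * y) := by field_simp
      _ ≤ Real.sin (π * y) := h
  rcases le_or_gt 0 (x - k) with h0 | h0
  · rw [abs_of_nonneg h0] at hk ⊢
    have := key (x - k) h0 hk
    rw [abs_of_nonneg (by linarith)]
    linarith
  · rw [abs_of_neg h0] at hk
    have h2 := key (-(x - k)) (by linarith) hk
    rw [abs_of_neg h0, show π * (x - ↑k) = -(π * -(x - ↑k)) by ring, Real.sin_neg, abs_neg,
      abs_of_nonneg (by linarith)]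
    linarith

/-- **The grid phase ratio against the cyclic distance**: for `N ≥ 1` and integers `j₁, j₀`,
`4·cyclicDist N j₁ j₀ / N ≤ ‖e^{2πi(j₁−j₀)/N} − 1‖`. -/
theorem cyclicDist_div_le_norm_gridPhase_sub_one (N : ℕ) [NeZero N] (j₁ j₀ : ℤ) :
    4 * cyclicDist N (j₁ : ZMod N) (j₀ : ZMod N) / N ≤ ‖cexp (I * ((2 * π * (((j₁ - j₀ : ℤ) : ℝ) / N) : ℝ) : ℂ)) - 1‖ := by
  have hN : (0 : ℝ) < N := by exact_mod_cast Nat.pos_of_ne_zero (NeZero.ne N)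
  set z : ℤ := j₁ - j₀ with hz
  set v : ℕ := ((j₁ : ZMod N) - (j₀ : ZMod N)).val with hv
  have hvz : (v : ℤ) = z % N := by
    rw [hv, ← ZMod.val_intCast, hz]; push_cast; rfl
  have hvN : v < N := ZMod.val_lt _
  have hzdecomp : (z : ℝ) / N = ((z / N : ℤ) : ℝ) + (v : ℝ) / N := by
    have h1 : (z : ℤ) = N * (z / N) + v := by rw [hvz]; exact (Int.mul_ediv_add_emod z N).symm  -- z = N*(z/N) + z%N
    have h2 : (z : ℝ) = (N : ℝ) * ((z / N : ℤ) : ℝ) + v := by exact_mod_cast h1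
    rw [h2]; field_simp
  -- `cyclicDist = min(v, N - v)`
  have hcd : cyclicDist N (j₁ : ZMod N) (j₀ : ZMod N) = ((min v (N - v) : ℕ) : ℝ) := rfl
  rw [hcd]
  rcases le_or_gt (2 * v) N with hsmall | hbig
  · -- nearest integer below: `|z/N − (z/N)| = v/N ≤ 1/2`
    have hmin : ((min v (N - v) : ℕ) : ℝ) = v := by rw [min_eq_left (by omega)]
    have hk : |(z : ℝ) / N - ((z / N : ℤ) : ℝ)| ≤ 1 / 2 := by
      rw [hzdecomp, add_sub_cancel_left, abs_of_nonneg (by positivity), div_le_iff₀ hN]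
      have : (2 * v : ℝ) ≤ N := by exact_mod_cast hsmall
      linarith
    have h := four_mul_abs_sub_le_norm_cexp_sub_one ((z : ℝ) / N) (z / N) hk
    rw [hzdecomp, add_sub_cancel_left, abs_of_nonneg (by positivity)] at h
    rw [hmin]
    calc (4 : ℝ) * v / N = 4 * ((v : ℝ) / N) := by ring
      _ ≤ _ := by rw [← hzdecomp] at h; exact h
  · -- nearest integer above: `|z/N − (z/N + 1)| = (N − v)/N < 1/2`
    have hvle : (v : ℝ) ≤ N := by exact_mod_cast hvN.le
    have hmin : ((min v (N - v) : ℕ) : ℝ) = (N : ℝ) - v := by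
      rw [min_eq_right (by omega), Nat.cast_sub hvN.le]
    have hdiffk : (z : ℝ) / N - (((z / N + 1 : ℤ)) : ℝ) = -(((N : ℝ) - v) / N) := by
      rw [hzdecomp]; push_cast; field_simp; ring
    have habs : |(z : ℝ) / N - (((z / N + 1 : ℤ)) : ℝ)| = ((N : ℝ) - v) / N := by
      rw [hdiffk, abs_neg, abs_of_nonneg (div_nonneg (by linarith) hN.le)]
    have hk : |(z : ℝ) / N - (((z / N + 1 : ℤ)) : ℝ)| ≤ 1 / 2 := by
      rw [habs, div_le_iff₀ hN]
      have : (N : ℝ) < 2 * v := by exact_mod_cast hbig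
      linarith
    have h := four_mul_abs_sub_le_norm_cexp_sub_one ((z : ℝ) / N) (z / N + 1) hk
    rw [habs] at h
    rw [hmin]
    calc 4 * ((N : ℝ) - v) / N = 4 * (((N : ℝ) - v) / N) := by ring
      _ ≤ _ := h

/-! ## §3 The window as an arithmetic progression -/

/-- `ω_i = −π(2M−1)/β + i·(2π/β)` for `i : MatsubaraIdx M` read as a natural number. -/
theorem matsubaraFreq_eq_affine (β : ℝ) (M : ℕ) (i : MatsubaraIdx M) :
    matsubaraFreq β M i = -(π * (2 * M - 1) / β) + (i : ℕ) * (2 * π / β) := by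
  simp only [matsubaraFreq, matsubaraInt]
  push_cast
  ring

/-- The window sum as a `range (2M)` sum along the progression. -/
theorem sum_matsubaraIdx_eq_sum_range {α : Type*} [AddCommMonoid α] (β : ℝ) (M : ℕ) (f : ℝ → α) :
    ∑ i : MatsubaraIdx M, f (matsubaraFreq β M i) = ∑ n ∈ range (2 * M), f (-(π * (2 * M - 1) / β) + n * (2 * π / β)) := by
  simp_rw [matsubaraFreq_eq_affine]
  exact Fin.sum_univ_eq_sum_range (fun n : ℕ => f (-(π * (2 * M - 1) / β) + n * (2 * π / β))) (2 * M)

/-- **No-decay window bound**: `Σ_{i∈window} 1/max(|ω_i|, Λ/2)² ≤ β·(2/Λ)` (`0 < β`, `0 < Λ`; β-uniform). -/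
theorem sum_matsubaraIdx_one_div_max_sq_le {β Λ : ℝ} (hβ : 0 < β) (hΛ : 0 < Λ) (M : ℕ) :
    ∑ i : MatsubaraIdx M, 1 / max |matsubaraFreq β M i| (Λ / 2) ^ 2 ≤ β * (2 / Λ) := by
  obtain ⟨hsum, hle⟩ := tsum_int_one_div_beta_mul_max_sq_le hβ (half_pos hΛ)
  rw [sum_matsubaraIdx_freq_eq_sum_Ico β M (fun ω => 1 / max |ω| (Λ / 2) ^ 2)]
  have h1 : ∀ n : ℤ, 1 / max |(2 * (n : ℝ) + 1) * π / β| (Λ / 2) ^ 2 = β * (1 / (β * max |(2 * (n : ℝ) + 1) * π / β| (Λ / 2) ^ 2)) := by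
    intro n
    have : 0 < max |(2 * (n : ℝ) + 1) * π / β| (Λ / 2) := lt_max_of_lt_right (half_pos hΛ)
    field_simp
  simp_rw [h1]
  rw [← mul_sum]
  refine mul_le_mul_of_nonneg_left ?_ hβ.le
  calc ∑ n ∈ Finset.Ico (-(M : ℤ)) M, 1 / (β * max |(2 * (n : ℝ) + 1) * π / β| (Λ / 2) ^ 2)
      ≤ ∑' n : ℤ, 1 / (β * max |(2 * (n : ℝ) + 1) * π / β| (Λ / 2) ^ 2) :=
        hsum.sum_le_tsum _ fun n _ => by
          have : 0 < max |(2 * (n : ℝ) + 1) * π / β| (Λ / 2) := lt_max_of_lt_right (half_pos hΛ)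
          positivity
    _ ≤ 1 / (Λ / 2) := hle
    _ = 2 / Λ := by field_simp

/-! ## §4 The window sum against frequency jets: iterated Abel summation -/

/-- **TIME DECAY OF A WINDOW SUM FROM FREQUENCY JETS.**  Let `H ∈ C^{N′}(ℝ)` with `‖H^{(i)}(ω)‖ ≤ A_i/max(|ω|,Λ/2)^{i+1}` for `i ≤ N′` (`A_i ≥ 0`,
`N′ ≥ 1`), `0 < β`, `M ≥ 2N′+1`, and `q` unimodular with `‖q − 1‖ ≥ v/M` (`v > 0`).  Then along the window `ω_n = −π(2M−1)/β + n·2π/β`: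
`‖Σ_{n<2M} qⁿ·H(ω_n)‖ ≤ β·Σ_{i<N′} 2·max(i,1)·2ⁱ·A_i/(π·v^{i+1}) + N′·A_{N′}·(2π(2/Λ)^{N′})·(2π/β)^{N′−1}·(M/v)^{N′}`
(edge terms of the sharp window; bulk from `∫‖H^{(N′)}‖ ≤ A_{N′}·2π(2/Λ)^{N′}`). -/
theorem norm_windowSum_le_of_jets {H : ℝ → ℂ} {N' : ℕ} (hN' : 1 ≤ N') (hH : ContDiff ℝ N' H) {Λ : ℝ} (hΛ : 0 < Λ)
    {A : ℕ → ℝ} (hA0 : ∀ i, 0 ≤ A i) (hjet : ∀ i ≤ N', ∀ ω : ℝ, ‖iteratedDeriv i H ω‖ ≤ A i / max |ω| (Λ / 2) ^ (i + 1))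
    {β : ℝ} (hβ : 0 < β) {M : ℕ} (hM : 2 * N' + 1 ≤ M) {q : ℂ} (hq1 : ‖q‖ = 1) {v : ℝ} (hv : 0 < v) (hqv : v / M ≤ ‖q - 1‖) :
    ‖∑ n ∈ range (2 * M), q ^ n * H (-(π * (2 * M - 1) / β) + n * (2 * π / β))‖ ≤
      β * (∑ i ∈ range N', 2 * ((max i 1 : ℕ) : ℝ) * 2 ^ i * A i / (π * v ^ (i + 1))) +
        N' * A N' * (2 * π * (2 / Λ) ^ N') * (2 * π / β) ^ (N' - 1) * ((M : ℝ) / v) ^ N' := by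
  have hMpos : (0 : ℝ) < M := by exact_mod_cast (show 0 < M by omega)
  have hq0 : 0 < ‖q - 1‖ := lt_of_lt_of_le (by positivity) hqv
  have hq : q ≠ 1 := fun h => by rw [h, sub_self, norm_zero] at hq0; exact lt_irrefl _ hq0
  set ω₀ : ℝ := -(π * (2 * M - 1) / β) with hω₀
  set h : ℝ := 2 * π / β with hh
  have hh0 : 0 ≤ h := by positivity
  set a : ℕ → ℂ := fun n => H (ω₀ + n * h) with ha
  have habel := norm_abel_sum_le hq1 hq N' a (2 * M) (by omega)
  -- differences of the samples are `h`-differences of `H`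
  have hdiff : ∀ i n : ℕ, (Δ_[1])^[i] a n = (Δ_[h])^[i] H (ω₀ + n * h) := fun i n => fwdDiff_iter_samples H ω₀ h i n
  -- the edge windows sit at `|ω| ≥ πM/β`
  have hMβ : 0 < π * M / β := by positivity
  have hedge_env : ∀ t : ℝ, π * M / β ≤ |t| → ∀ i : ℕ, A i / max |t| (Λ / 2) ^ (i + 1) ≤ A i * (β / (π * M)) ^ (i + 1) := by
    intro t ht i
    have hm : π * M / β ≤ max |t| (Λ / 2) := ht.trans (le_max_left _ _)
    rw [div_eq_mul_inv, ← inv_pow, show β / (π * M) = (π * M / β)⁻¹ by rw [inv_div]]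
    exact mul_le_mul_of_nonneg_left (pow_le_pow_left₀ (by positivity) (inv_anti₀ hMβ hm) _) (hA0 i)
  have hedgeL : ∀ i < N', ∀ t ∈ Icc ω₀ (ω₀ + i * h), π * M / β ≤ |t| := by
    intro i hi t ht
    have h2 : ω₀ + i * h ≤ -(π * M / β) := by
      rw [hω₀, hh]
      have hiM : (2 * i + 1 : ℝ) + M ≤ 2 * M := by exact_mod_cast (show 2 * i + 1 + M ≤ 2 * M by omega)
      rw [show -(π * (2 * M - 1) / β) + i * (2 * π / β) = -(π * (2 * M - (2 * i + 1)) / β) by ring, neg_le_neg_iff,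
        div_le_div_iff_of_pos_right hβ]
      nlinarith [Real.pi_pos]
    have ht' : t ≤ -(π * M / β) := ht.2.trans h2
    rw [abs_of_nonpos (by linarith)]; linarith
  have hedgeR : ∀ i < N', ∀ t ∈ Icc (ω₀ + ((2 * M - (i + 1) : ℕ) : ℝ) * h) (ω₀ + ((2 * M - (i + 1) : ℕ) : ℝ) * h + i * h), π * M / β ≤ |t| := by
    intro i hi t ht
    have h2 : π * M / β ≤ ω₀ + ((2 * M - (i + 1) : ℕ) : ℝ) * h := by
      rw [hω₀, hh, Nat.cast_sub (by omega)]
      push_cast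
      have hiM : (M : ℝ) ≤ 2 * M - (2 * i + 1) := by
        have : (2 * i + 1 + M : ℝ) ≤ 2 * M := by exact_mod_cast (show 2 * i + 1 + M ≤ 2 * M by omega)
        linarith
      rw [show -(π * (2 * M - 1) / β) + (2 * M - (i + 1)) * (2 * π / β) = π * (2 * M - (2 * i + 1)) / β by ring,
        div_le_div_iff_of_pos_right hβ]
      nlinarith [Real.pi_pos]
    have ht' : π * M / β ≤ t := h2.trans ht.1
    rw [abs_of_nonneg (by linarith)]; exact ht'
  -- EDGE TERMS
  have hedge : ∀ i < N', ∀ x : ℝ, (∀ t ∈ Icc x (x + i * h), π * M / β ≤ |t|) →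
      ‖(Δ_[h])^[i] H x‖ ≤ ((max i 1 : ℕ) : ℝ) * h ^ i * (A i * (β / (π * M)) ^ (i + 1)) := by
    intro i hi x hx
    rcases Nat.eq_zero_or_pos i with rfl | hi1
    · have h0 := hjet 0 (by omega) x
      have henv := hedge_env x (hx x ⟨le_rfl, by simp⟩) 0
      simp only [iteratedDeriv_zero, zero_add, pow_one] at h0 henv
      simpa using h0.trans henv
    · rw [max_eq_left hi1]
      exact norm_fwdDiff_iter_le_pow_mul hh0 hi1 (hH.of_le (by exact_mod_cast hi.le)) x fun t ht =>
        (hjet i hi.le t).trans (hedge_env t (hx t ht) i)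
  -- BULK TERM
  have hint_dom : Integrable (fun ω : ℝ => A N' * (1 / max |ω| (Λ / 2) ^ (N' + 1))) :=
    (integrable_one_div_max_abs_pow (half_pos hΛ) (by omega)).const_mul _
  have hcontN : Continuous fun ω => ‖iteratedDeriv N' H ω‖ := (hH.continuous_iteratedDeriv N' le_rfl).norm
  have hint : Integrable (fun ω : ℝ => ‖iteratedDeriv N' H ω‖) := by
    refine hint_dom.mono' hcontN.aestronglyMeasurable (ae_of_all _ fun ω => ?_)
    rw [norm_norm]
    exact (hjet N' le_rfl ω).trans (le_of_eq (by ring))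
  have hI : ∫ ω, ‖iteratedDeriv N' H ω‖ ≤ A N' * (2 * π * (2 / Λ) ^ N') := by
    calc ∫ ω, ‖iteratedDeriv N' H ω‖ ≤ ∫ ω, A N' * (1 / max |ω| (Λ / 2) ^ (N' + 1)) :=
          integral_mono_of_nonneg (ae_of_all _ fun _ => norm_nonneg _) hint_dom (ae_of_all _ fun ω => (hjet N' le_rfl ω).trans (le_of_eq (by ring)))
      _ = A N' * ∫ ω, 1 / max |ω| (Λ / 2) ^ (N' + 1) := MeasureTheory.integral_const_mul _ _
      _ ≤ A N' * (2 * π * (1 / (Λ / 2)) ^ (N' + 1 - 1)) :=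
          mul_le_mul_of_nonneg_left (integral_one_div_max_abs_pow_le (half_pos hΛ) (by omega)) (hA0 _)
      _ = A N' * (2 * π * (2 / Λ) ^ N') := by rw [Nat.add_sub_cancel, one_div_div]
  have hbulk : ∑ n ∈ range (2 * M - N'), ‖(Δ_[1])^[N'] a n‖ ≤ h ^ (N' - 1) * (N' * (A N' * (2 * π * (2 / Λ) ^ N'))) := by
    calc ∑ n ∈ range (2 * M - N'), ‖(Δ_[1])^[N'] a n‖
        ≤ ∑ n ∈ range (2 * M - N'), h ^ (N' - 1) * ∫ t in (ω₀ + n * h)..(ω₀ + n * h + N' * h), ‖iteratedDeriv N' H t‖ := by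
          refine sum_le_sum fun n _ => ?_
          rw [hdiff]
          exact norm_fwdDiff_iter_le_integral hh0 N' hN' H hH _
      _ = h ^ (N' - 1) * ∑ n ∈ range (2 * M - N'), ∫ t in (ω₀ + n * h)..(ω₀ + n * h + N' * h), ‖iteratedDeriv N' H t‖ := by
          rw [mul_sum]
      _ ≤ h ^ (N' - 1) * (N' * ∫ t, ‖iteratedDeriv N' H t‖) :=
          mul_le_mul_of_nonneg_left (sum_integral_window_le hint (fun _ => norm_nonneg _) ω₀ h hh0 N' _) (by positivity)
      _ ≤ h ^ (N' - 1) * (N' * (A N' * (2 * π * (2 / Λ) ^ N'))) := by gcongr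
  -- ASSEMBLY
  have hqv' : ∀ m : ℕ, ((v : ℝ) / M) ^ m ≤ ‖q - 1‖ ^ m := fun m => pow_le_pow_left₀ (by positivity) hqv m
  refine habel.trans ?_
  refine add_le_add ?_ ?_
  · -- edges
    rw [mul_sum]
    refine sum_le_sum fun i hi => ?_
    rw [Finset.mem_range] at hi
    have hR := hedge i hi _ (hedgeR i hi)
    have hL := hedge i hi ω₀ (by simpa using hedgeL i hi)
    rw [hdiff, hdiff, Nat.cast_zero, zero_mul, add_zero]
    have hE : 0 ≤ ((max i 1 : ℕ) : ℝ) * h ^ i * (A i * (β / (π * M)) ^ (i + 1)) :=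
      mul_nonneg (mul_nonneg (Nat.cast_nonneg _) (pow_nonneg hh0 _)) (mul_nonneg (hA0 i) (by positivity))
    calc (‖(Δ_[h])^[i] H (ω₀ + ((2 * M - (i + 1) : ℕ) : ℝ) * h)‖ + ‖(Δ_[h])^[i] H ω₀‖) / ‖q - 1‖ ^ (i + 1)
        ≤ (((max i 1 : ℕ) : ℝ) * h ^ i * (A i * (β / (π * M)) ^ (i + 1)) + ((max i 1 : ℕ) : ℝ) * h ^ i * (A i * (β / (π * M)) ^ (i + 1))) /
            ((v : ℝ) / M) ^ (i + 1) :=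
          div_le_div₀ (add_nonneg hE hE) (add_le_add hR hL) (by positivity) (hqv' _)
      _ = β * (2 * ((max i 1 : ℕ) : ℝ) * 2 ^ i * A i / (π * v ^ (i + 1))) := by
          have hβ' : β ≠ 0 := hβ.ne'
          have hv' : v ≠ 0 := hv.ne'
          have hM' : (M : ℝ) ≠ 0 := hMpos.ne'
          have hπ : (π : ℝ) ≠ 0 := Real.pi_pos.ne'
          rw [div_eq_iff (by positivity), hh, div_pow, div_pow, div_pow]
          field_simp
          ring
  · -- bulk
    calc (∑ n ∈ range (2 * M - N'), ‖(Δ_[1])^[N'] a n‖) / ‖q - 1‖ ^ N'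
        ≤ (h ^ (N' - 1) * (N' * (A N' * (2 * π * (2 / Λ) ^ N')))) / ((v : ℝ) / M) ^ N' :=
          div_le_div₀ (mul_nonneg (pow_nonneg hh0 _) (mul_nonneg (Nat.cast_nonneg _) (mul_nonneg (hA0 _) (by positivity))))
            hbulk (by positivity) (hqv' _)
      _ = N' * A N' * (2 * π * (2 / Λ) ^ N') * (2 * π / β) ^ (N' - 1) * ((M : ℝ) / v) ^ N' := by
          rw [hh, div_eq_mul_inv, ← inv_pow, inv_div]
          ring

end Summit.HubbardSuperconductivity.HubbardSuperconductivity.Theorems.KLRegimeSplit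

end
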